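import Summits.BirchSwinnertonDyer.BirchSwinnertonDyer.Theorems.PrintCf2RubinValueTwoLeopoldtUnitsSemilocalGaloisBridge
import Literature.NumberTheory.GaloisRepresentations.SemiLocalShapiro
import HarnessLib

/-!
# The Galois bridge at a fixed place (FILE C, piece (C-δ1)): the decomposition group of `w` acts on the `w`-component of
# ty2's local units through the local Galois automorphisms `decompAlgEquiv`

Cell `bsd-print-cf2`, width seat `bsd-line-cf2-p1-w8` g8, `--supports` the DECIDING class crux
`PrintCf2RubinValueTwo.MainConjClauseAtSplitTwoQuadDAClass` (stmt-BirchSwinnertonDyer-23300; stub `stub_localAtom` / (U1) f.g. half)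
as a helper. THEOREMS ONLY; Theses-free. HONEST FRAMING: dictionary lemmas; no summit statement is proved; BSD is not proved.

WHAT. `piEquiv_map_apply_of_smul_eq` — the equivariance `…SemilocalGaloisBridge.piEquiv_map_apply_smul` with an arbitrary target
place `w'`, `σ • w = w'` (the transport datum of `galAdicCompletionMap` is proof-irrelevant); ★ `piEquiv_galTranslateU_apply_of_stabilizer`
— for `σ ∈ Γ_K` whose restriction `σ̄` fixes the place `w`, the `w`-component of `galTranslateU σ u` is
`SemiLocal.decompAlgEquiv w σ̄ (u_w)`: the `w`-block of `U(E)` (units supported at `w`, `…SemilocalBlocks`) with its `Stab(w)`-action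
IS the principal-unit group of the local field `E_w` acted on by `Stab(w) ≅ Gal(E_w/K_v)` (`SemiLocalShapiro.decompMulEquiv`,
`isGalois_place`) — the format in which cf2c-w5 g11's local devissage `LeopoldtAtV.exists_cover_of_devissage` and its inputs
`…LocalCyclicInputs` (Hilbert 90 on the local field, local reciprocity) are stated. With `…SemilocalOrbitAssembly` this leaves,
for the f.g. atom, exactly the LOCAL covers per representative place (C-δ) and the orbit hypothesis `hreach`.

References: Cassels–Fröhlich (1967) Ch. VII §1.1 [CasselsFrohlichANT1967]; K. Rubin, Invent. Math. 103 (1991) §4 p. 36 [Rubin1991].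
-/

noncomputable section

set_option linter.dupNamespace false
set_option autoImplicit false

open NumberField IsDedekindDomain
open scoped TensorProduct
open Literature.NumberTheory.NumberFields Literature.NumberTheory.GaloisRepresentations
  Literature.NumberTheory.Automorphic Literature.NumberTheory.ComplexMultiplication.EllipticUnits

namespace Summit.BirchSwinnertonDyer.BirchSwinnertonDyer.Theorems.PrintCf2.UnitsFGLayerBound

variable (K : Type) [Field K] [NumberField K] (v : HeightOneSpectrum (𝓞 K)) (F : Type) [Field F] [NumberField F] [Algebra K F]

/-! ### §6. Equivariance with an arbitrary target place; the decomposition group acts on the `w`-component -/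

/-- **Equivariance of `piEquiv`, target form**: for `σ ∈ Gal(F/K)` and places `w, w'` above `v` with `σ • w = w'`, the
`w'`-component of the image of `(1 ⊗ σ) z` is `σ_w` of the `w`-component of the image of `z` (`piEquiv_map_apply_smul` with the
proof-irrelevant transport datum of `galAdicCompletionMap`). [cite: CasselsFrohlichANT1967, Ch. VII §1.1] -/
theorem piEquiv_map_apply_of_smul_eq (σ : F ≃ₐ[K] F) (z : Semilocal.Alg K v F) (w w' : v.Extension (𝓞 F))
    (h : σ • w.1 = w'.1) :
    Semilocal.piEquiv K v F (Semilocal.map K v (σ : F →ₐ[K] F) z) w' = galAdicCompletionMap σ h (Semilocal.piEquiv K v F z w) := by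
  obtain ⟨w'₁, hw'⟩ := w'
  simp only at h
  subst h
  exact piEquiv_map_apply_smul K v F σ z w

variable (E : IntermediateField K (AlgebraicClosure K)) [Normal K E] [NumberField E]

/-- **The decomposition group of `w` acts on the `w`-component through the local Galois action**: if `σ̄ = σ|_E` fixes the place
`w` (i.e. `σ̄ ∈ Stab(w)`), the `w`-component of ty2's `galTranslateU σ u` is the Childress-road `decompAlgEquiv w σ̄` (the
`K_v`-automorphism `σ_w` of `E_w`) applied to the `w`-component of `u`. So the `w`-block of `U(E)` with its `Stab(w)`-action IS
the group of principal units of the local field `E_w` with `Gal(E_w/K_v) ⊇ Stab(w)` (`decompMulEquiv`, `isGalois_place`) — the input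
format of the local devissage `LeopoldtAtV.exists_cover_of_devissage`. [cite: CasselsFrohlichANT1967, Ch. VII §1.1] -/
theorem piEquiv_galTranslateU_apply_of_stabilizer (σ : Field.absoluteGaloisGroup K) (u : ↥(Semilocal.principalUnits K v E))
    (w : SemiLocal.Place K E v) (hσ : (σ.restrictNormal E : E ≃ₐ[K] E) ∈ MulAction.stabilizer (E ≃ₐ[K] E) w) :
    Semilocal.piEquiv K v E ((((galTranslateU v E σ u : ↥(Semilocal.principalUnits K v E)) : (Semilocal.order K v E)ˣ) :
        Semilocal.order K v E) : Semilocal.Alg K v E) (show v.Extension (𝓞 E) from w) =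
      SemiLocal.decompAlgEquiv w ⟨(σ.restrictNormal E : E ≃ₐ[K] E), hσ⟩
        (Semilocal.piEquiv K v E ((((u : (Semilocal.order K v E)ˣ) : Semilocal.order K v E) : Semilocal.Alg K v E))
          (show v.Extension (𝓞 E) from w)) := by
  rw [SemiLocal.decompAlgEquiv_apply, coe_galTranslateU_apply, coe_galTranslate]
  exact piEquiv_map_apply_of_smul_eq K v E (σ.restrictNormal E) _ (show v.Extension (𝓞 E) from w)
    (show v.Extension (𝓞 E) from w) (SemiLocal.coe_stabilizer_smul w ⟨_, hσ⟩)

end Summit.BirchSwinnertonDyer.BirchSwinnertonDyer.Theorems.PrintCf2.UnitsFGLayerBound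

end
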